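import Summits.BirchSwinnertonDyer.BirchSwinnertonDyer.Theorems.Rank2ObservatoryRank2Table
import Summits.BirchSwinnertonDyer.BirchSwinnertonDyer.Theorems.Rank2ObservatoryRank2Rows40a
import Summits.BirchSwinnertonDyer.BirchSwinnertonDyer.Theorems.Rank2ObservatoryRank2Rows40b
import Summits.BirchSwinnertonDyer.BirchSwinnertonDyer.Theorems.Rank2ObservatoryRank2Rows41a
import Summits.BirchSwinnertonDyer.BirchSwinnertonDyer.Theorems.Rank2ObservatoryRank2Rows41b
import Summits.BirchSwinnertonDyer.BirchSwinnertonDyer.Theorems.Rank2ObservatoryRank2Rows42a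
import Summits.BirchSwinnertonDyer.BirchSwinnertonDyer.Theorems.Rank2ObservatoryRank2Rows42b
import Summits.BirchSwinnertonDyer.BirchSwinnertonDyer.Theorems.Rank2ObservatoryRank2Rows43a
import Summits.BirchSwinnertonDyer.BirchSwinnertonDyer.Theorems.Rank2ObservatoryRank2Rows43b
import Summits.BirchSwinnertonDyer.BirchSwinnertonDyer.Theorems.Rank2ObservatoryRank2Rows44a
import Summits.BirchSwinnertonDyer.BirchSwinnertonDyer.Theorems.Rank2ObservatoryRank2Rows44b
import Summits.BirchSwinnertonDyer.BirchSwinnertonDyer.Theorems.Rank2ObservatoryRank2Rows45a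
import Summits.BirchSwinnertonDyer.BirchSwinnertonDyer.Theorems.Rank2ObservatoryRank2Rows45b
import Summits.BirchSwinnertonDyer.BirchSwinnertonDyer.Theorems.Rank2ObservatoryRank2Rows46a
import Summits.BirchSwinnertonDyer.BirchSwinnertonDyer.Theorems.Rank2ObservatoryRank2Rows46b
import Summits.BirchSwinnertonDyer.BirchSwinnertonDyer.Theorems.Rank2ObservatoryRank2Rows47a
import Summits.BirchSwinnertonDyer.BirchSwinnertonDyer.Theorems.Rank2ObservatoryRank2Rows47b
import Summits.BirchSwinnertonDyer.BirchSwinnertonDyer.Theorems.Rank2ObservatoryRank2Rows48a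
import Summits.BirchSwinnertonDyer.BirchSwinnertonDyer.Theorems.Rank2ObservatoryRank2Rows48b
import Summits.BirchSwinnertonDyer.BirchSwinnertonDyer.Theorems.Rank2ObservatoryRank2Rows49a
import Summits.BirchSwinnertonDyer.BirchSwinnertonDyer.Theorems.Rank2ObservatoryRank2Rows49b
import HarnessLib

/-!
# BirchSwinnertonDyer — rank ≥ 2 observatory: rank-2 census table, decade 4 of 10 (`200000 ≤ N < 250000`)

HONEST FRAMING: per-curve certified theorems and census instruments; no claim on BSD in rank ≥ 2.

Machine-written AGGREGATION level of the rank-2 census (schema `Rank2ObservatoryRank2Table.lean`, data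
chunks `Rank2ObservatoryRank2Rows40a … 49b`, census `Rank2ObservatoryRank2Census.lean`): `rank2Decade4` is the
concatenation of the 20 chunks of conductor windows 40–49 (`200000 ≤ N < 250000`; a window above the gate's
200 kB file cap is stored as two half-window chunks `NNa`, `NNb`) — rows 126844–162955 of `rank2_table.tsv`
(sha256 `8b151c933b69ee8dae4834c21efd171353ae94c887716c05b7381d12d173f912`), 36112 curves from `200007a1` to
`249998h2`. Its theorems are assembled from the chunk theorems (each a kernel `decide`) by
`List.all_append` / `List.length_append` rewriting only; no row is re-evaluated here. The two-level
assembly (chunks → decades → table) keeps every file under the tree's 400-line limit and every list short.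

Reference: J. E. Cremona, *Algorithms for Modular Elliptic Curves* (2nd ed. 1997), tables / ecdata.
-/

-- single-conjunct summit: `Summit.BirchSwinnertonDyer.BirchSwinnertonDyer.…` repeats the name by design
set_option linter.dupNamespace false

namespace Summit.BirchSwinnertonDyer.BirchSwinnertonDyer.Rank2Observatory

/-- The 20 chunks of decade 4 (conductors `200000 ≤ N < 250000`), in order. [cite: CremonaAlgorithms1997, Tables] -/
noncomputable def rank2Decade4Chunks : List (List Rank2Row) := [
  rank2Rows40a, rank2Rows40b, rank2Rows41a, rank2Rows41b, rank2Rows42a, rank2Rows42b,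
  rank2Rows43a, rank2Rows43b, rank2Rows44a, rank2Rows44b, rank2Rows45a, rank2Rows45b,
  rank2Rows46a, rank2Rows46b, rank2Rows47a, rank2Rows47b, rank2Rows48a, rank2Rows48b,
  rank2Rows49a, rank2Rows49b]

/-- Decade 4 of the rank-2 census table: the 36112 rank-2 curves of conductor `200000 ≤ N < 250000` (rows 126844–162955).
[cite: CremonaAlgorithms1997, Tables] -/
noncomputable def rank2Decade4 : List Rank2Row :=
  rank2Decade4Chunks.flatten

/-- Every row of decade 4 satisfies `Rank2Row.check` (from the 20 chunk theorems). [folklore] -/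
theorem rank2Decade4_check : rank2Decade4.all Rank2Row.check = true := by
  simp only [rank2Decade4, rank2Decade4Chunks, List.flatten_cons, List.flatten_nil, List.all_append, List.all_nil,
    Bool.and_true,
    rank2Rows40a_check, rank2Rows40b_check, rank2Rows41a_check, rank2Rows41b_check,
    rank2Rows42a_check, rank2Rows42b_check, rank2Rows43a_check, rank2Rows43b_check,
    rank2Rows44a_check, rank2Rows44b_check, rank2Rows45a_check, rank2Rows45b_check,
    rank2Rows46a_check, rank2Rows46b_check, rank2Rows47a_check, rank2Rows47b_check,
    rank2Rows48a_check, rank2Rows48b_check, rank2Rows49a_check, rank2Rows49b_check]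

/-- Decade 4 has `36112` rows (sum of the 20 kernel-counted chunk lengths). [cite: CremonaAlgorithms1997, Tables] -/
theorem rank2Decade4_length : rank2Decade4.length = 36112 := by
  simp only [rank2Decade4, rank2Decade4Chunks, List.flatten_cons, List.flatten_nil, List.length_append, List.length_nil,
    rank2Rows40a_length, rank2Rows40b_length, rank2Rows41a_length, rank2Rows41b_length,
    rank2Rows42a_length, rank2Rows42b_length, rank2Rows43a_length, rank2Rows43b_length,
    rank2Rows44a_length, rank2Rows44b_length, rank2Rows45a_length, rank2Rows45b_length,
    rank2Rows46a_length, rank2Rows46b_length, rank2Rows47a_length, rank2Rows47b_length,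
    rank2Rows48a_length, rank2Rows48b_length, rank2Rows49a_length, rank2Rows49b_length]

/-- Every conductor of decade 4 is `< 500 000` (from the 20 kernel-checked chunk ranges).
[cite: CremonaAlgorithms1997, Tables] -/
theorem rank2Decade4_conductor_lt : rank2Decade4.all (fun r => decide (r.N < 500000)) = true := by
  simp only [rank2Decade4, rank2Decade4Chunks, List.flatten_cons, List.flatten_nil, List.all_append, List.all_nil,
    Bool.and_true,
    Rank2Row.all_conductorLt_of_all_range (by norm_num) rank2Rows40a_conductor,
    Rank2Row.all_conductorLt_of_all_range (by norm_num) rank2Rows40b_conductor,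
    Rank2Row.all_conductorLt_of_all_range (by norm_num) rank2Rows41a_conductor,
    Rank2Row.all_conductorLt_of_all_range (by norm_num) rank2Rows41b_conductor,
    Rank2Row.all_conductorLt_of_all_range (by norm_num) rank2Rows42a_conductor,
    Rank2Row.all_conductorLt_of_all_range (by norm_num) rank2Rows42b_conductor,
    Rank2Row.all_conductorLt_of_all_range (by norm_num) rank2Rows43a_conductor,
    Rank2Row.all_conductorLt_of_all_range (by norm_num) rank2Rows43b_conductor,
    Rank2Row.all_conductorLt_of_all_range (by norm_num) rank2Rows44a_conductor,
    Rank2Row.all_conductorLt_of_all_range (by norm_num) rank2Rows44b_conductor,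
    Rank2Row.all_conductorLt_of_all_range (by norm_num) rank2Rows45a_conductor,
    Rank2Row.all_conductorLt_of_all_range (by norm_num) rank2Rows45b_conductor,
    Rank2Row.all_conductorLt_of_all_range (by norm_num) rank2Rows46a_conductor,
    Rank2Row.all_conductorLt_of_all_range (by norm_num) rank2Rows46b_conductor,
    Rank2Row.all_conductorLt_of_all_range (by norm_num) rank2Rows47a_conductor,
    Rank2Row.all_conductorLt_of_all_range (by norm_num) rank2Rows47b_conductor,
    Rank2Row.all_conductorLt_of_all_range (by norm_num) rank2Rows48a_conductor,
    Rank2Row.all_conductorLt_of_all_range (by norm_num) rank2Rows48b_conductor,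
    Rank2Row.all_conductorLt_of_all_range (by norm_num) rank2Rows49a_conductor,
    Rank2Row.all_conductorLt_of_all_range (by norm_num) rank2Rows49b_conductor]

/-- A row of a chunk of decade 4 is a row of the decade. [folklore] -/
theorem mem_rank2Decade4_of_mem_chunk {l : List Rank2Row} (hl : l ∈ rank2Decade4Chunks) {r : Rank2Row} (hr : r ∈ l) :
    r ∈ rank2Decade4 :=
  List.mem_flatten.mpr ⟨l, hl, hr⟩

/-- Chunk 40a is a chunk of decade 4. [folklore] -/
theorem rank2Rows40a_mem_decade4 : rank2Rows40a ∈ rank2Decade4Chunks :=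
  List.mem_iff_getElem?.mpr ⟨0, rfl⟩

/-- Chunk 40b is a chunk of decade 4. [folklore] -/
theorem rank2Rows40b_mem_decade4 : rank2Rows40b ∈ rank2Decade4Chunks :=
  List.mem_iff_getElem?.mpr ⟨1, rfl⟩

/-- Chunk 41a is a chunk of decade 4. [folklore] -/
theorem rank2Rows41a_mem_decade4 : rank2Rows41a ∈ rank2Decade4Chunks :=
  List.mem_iff_getElem?.mpr ⟨2, rfl⟩

/-- Chunk 41b is a chunk of decade 4. [folklore] -/
theorem rank2Rows41b_mem_decade4 : rank2Rows41b ∈ rank2Decade4Chunks :=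
  List.mem_iff_getElem?.mpr ⟨3, rfl⟩

/-- Chunk 42a is a chunk of decade 4. [folklore] -/
theorem rank2Rows42a_mem_decade4 : rank2Rows42a ∈ rank2Decade4Chunks :=
  List.mem_iff_getElem?.mpr ⟨4, rfl⟩

/-- Chunk 42b is a chunk of decade 4. [folklore] -/
theorem rank2Rows42b_mem_decade4 : rank2Rows42b ∈ rank2Decade4Chunks :=
  List.mem_iff_getElem?.mpr ⟨5, rfl⟩

/-- Chunk 43a is a chunk of decade 4. [folklore] -/
theorem rank2Rows43a_mem_decade4 : rank2Rows43a ∈ rank2Decade4Chunks :=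
  List.mem_iff_getElem?.mpr ⟨6, rfl⟩

/-- Chunk 43b is a chunk of decade 4. [folklore] -/
theorem rank2Rows43b_mem_decade4 : rank2Rows43b ∈ rank2Decade4Chunks :=
  List.mem_iff_getElem?.mpr ⟨7, rfl⟩

/-- Chunk 44a is a chunk of decade 4. [folklore] -/
theorem rank2Rows44a_mem_decade4 : rank2Rows44a ∈ rank2Decade4Chunks :=
  List.mem_iff_getElem?.mpr ⟨8, rfl⟩

/-- Chunk 44b is a chunk of decade 4. [folklore] -/
theorem rank2Rows44b_mem_decade4 : rank2Rows44b ∈ rank2Decade4Chunks :=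
  List.mem_iff_getElem?.mpr ⟨9, rfl⟩

/-- Chunk 45a is a chunk of decade 4. [folklore] -/
theorem rank2Rows45a_mem_decade4 : rank2Rows45a ∈ rank2Decade4Chunks :=
  List.mem_iff_getElem?.mpr ⟨10, rfl⟩

/-- Chunk 45b is a chunk of decade 4. [folklore] -/
theorem rank2Rows45b_mem_decade4 : rank2Rows45b ∈ rank2Decade4Chunks :=
  List.mem_iff_getElem?.mpr ⟨11, rfl⟩

/-- Chunk 46a is a chunk of decade 4. [folklore] -/
theorem rank2Rows46a_mem_decade4 : rank2Rows46a ∈ rank2Decade4Chunks :=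
  List.mem_iff_getElem?.mpr ⟨12, rfl⟩

/-- Chunk 46b is a chunk of decade 4. [folklore] -/
theorem rank2Rows46b_mem_decade4 : rank2Rows46b ∈ rank2Decade4Chunks :=
  List.mem_iff_getElem?.mpr ⟨13, rfl⟩

/-- Chunk 47a is a chunk of decade 4. [folklore] -/
theorem rank2Rows47a_mem_decade4 : rank2Rows47a ∈ rank2Decade4Chunks :=
  List.mem_iff_getElem?.mpr ⟨14, rfl⟩

/-- Chunk 47b is a chunk of decade 4. [folklore] -/
theorem rank2Rows47b_mem_decade4 : rank2Rows47b ∈ rank2Decade4Chunks :=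
  List.mem_iff_getElem?.mpr ⟨15, rfl⟩

/-- Chunk 48a is a chunk of decade 4. [folklore] -/
theorem rank2Rows48a_mem_decade4 : rank2Rows48a ∈ rank2Decade4Chunks :=
  List.mem_iff_getElem?.mpr ⟨16, rfl⟩

/-- Chunk 48b is a chunk of decade 4. [folklore] -/
theorem rank2Rows48b_mem_decade4 : rank2Rows48b ∈ rank2Decade4Chunks :=
  List.mem_iff_getElem?.mpr ⟨17, rfl⟩

/-- Chunk 49a is a chunk of decade 4. [folklore] -/
theorem rank2Rows49a_mem_decade4 : rank2Rows49a ∈ rank2Decade4Chunks :=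
  List.mem_iff_getElem?.mpr ⟨18, rfl⟩

/-- Chunk 49b is a chunk of decade 4. [folklore] -/
theorem rank2Rows49b_mem_decade4 : rank2Rows49b ∈ rank2Decade4Chunks :=
  List.mem_iff_getElem?.mpr ⟨19, rfl⟩

end Summit.BirchSwinnertonDyer.BirchSwinnertonDyer.Rank2Observatory
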